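import Literature.Geometry.Lorentzian.FutureCompleteDevelopmentCausalFuture
import HarnessLib

/-!
# The data hypersurface of a Cauchy development is acausal

For a Cauchy development `𝒟 = (M, g, τ, ι, ν)` (`CauchyDevelopment.lean`: `ι(X)` a Cauchy
hypersurface in O'Neill's sense, met exactly once by every endless timelike curve) the data
hypersurface `ι(X)` is SPACELIKE (the first-order tangency estimate
`DataEmbedding.eventually_abs_val_normal_le` against the future unit normal `ν`), and a spacelike
Cauchy hypersurface is acausal (O'Neill 1983, Ch. 14, Lemma 14.42 with Lemma 14.29:
`LorentzianMetric.IsCauchyHypersurface.false_of_isFutureCausalCurveOn_of_spacelike`,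
`SpacelikePieceDomain.lean`; for Cauchy developments the tree's
`CauchyDevelopment.false_of_isFutureCausalCurveOn_range_embed`, `CauchyDevelopmentPieceDomain.lean`).
This file records the consequences in the shapes consumed elsewhere:

* `CauchyDevelopment.eq_of_mem_causalFuture_range_embed` — **`ι(X)` is acausal**: for
  `p, q ∈ ι(X)`, `q ∈ J⁺(p)` forces `q = p`. This is the hypothesis `hac` carried by the tree's
  domain-of-dependence and horismos lemmas (`HypersurfaceShadowDomainCauchy`,
  `DataHypersurfaceLocalTrichotomy.causalFuture_subset_of_localTrichotomy`,
  `FutureCompleteDevelopmentCausalFuture`), now discharged for Cauchy developments;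
* `CauchyDevelopment.causalFuture_range_embed_subset_union` — the horismos of the data hypersurface
  is trivial: `J⁺(ι X) ⊆ ι(X) ∪ I⁺(ι X)` (O'Neill 1983, Lemma 14.42);
* `CauchyDevelopment.causalFuture_range_embed_subset'`,
  `CauchyDevelopment.EmbedsInto.exists_causalFuture_range_embed_subset'` — the theorems of
  `FutureCompleteDevelopmentCausalFuture` WITHOUT the acausality hypothesis: **a future timelike
  complete Cauchy development contains the causal future `J⁺(ι₂ X)` of the data of any Cauchy
  development of the same data it maps into** (in particular of the maximal one).

Everything is proved; no definitions and no named facts are introduced.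

## References

* B. O'Neill, *Semi-Riemannian geometry with applications to relativity*, Academic Press 1983,
  Ch. 14, Lemma 14.29 (p. 415) and Lemma 14.42 (p. 425). Key `ONeillSemiRiemannian1983`.
* S. W. Hawking, G. F. R. Ellis, *The large scale structure of space-time*, CUP 1973, §6.5.
-/

noncomputable section

open Set Function
open scoped Manifold ContDiff Topology

namespace Literature.Geometry.Lorentzian

open Literature.Geometry.Riemannian

universe u

variable {n : ℕ} {X : Type u} [TopologicalSpace X] [ChartedSpace (EuclideanSpace ℝ (Fin n)) X]
  [IsManifold (𝓡 n) ∞ X] [ConnectedSpace X] {D : InitialDataSet (𝓡 n) X}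

namespace CauchyDevelopment

/-- **The data hypersurface of a Cauchy development is acausal**: if `p, q ∈ ι(X)` and `q ∈ J⁺(p)`
then `q = p` (point form of `false_of_isFutureCausalCurveOn_range_embed`). O'Neill 1983, Ch. 14,
Lemma 14.42. [cite: ONeillSemiRiemannian1983, Ch. 14, Lemma 14.42 (p. 425)] -/
theorem eq_of_mem_causalFuture_range_embed (𝒟 : CauchyDevelopment D) :
    ∀ p ∈ range 𝒟.embed, ∀ q ∈ range 𝒟.embed,
      q ∈ 𝒟.metric.causalFuture 𝒟.timeOrientation {p} → q = p := by
  intro p hp q hq hpq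
  rcases hpq with hpq | ⟨w, hw, γ, a, b, hab, hγ, hγa, hγb⟩
  · exact mem_singleton_iff.1 hpq
  · rw [mem_singleton_iff] at hw
    exact (𝒟.false_of_isFutureCausalCurveOn_range_embed hab hγ (by rw [hγa, hw]; exact hp)
      (by rw [hγb]; exact hq)).elim

/-- **The horismos of the data hypersurface is trivial: `J⁺(ι X) ⊆ ι(X) ∪ I⁺(ι X)`** (O'Neill 1983,
Ch. 14, Lemma 14.42), from acausality, the causality condition of Cauchy developments and the local
trichotomy at the data hypersurface (`LorentzianMetric.causalFuture_subset_of_localTrichotomy`).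
[cite: ONeillSemiRiemannian1983, Ch. 14, Lemma 14.42 (p. 425)] -/
theorem causalFuture_range_embed_subset_union (𝒟 : CauchyDevelopment D) :
    𝒟.metric.causalFuture 𝒟.timeOrientation (range 𝒟.embed) ⊆
      range 𝒟.embed ∪ 𝒟.metric.chronologicalFuture 𝒟.timeOrientation (range 𝒟.embed) := by
  have hn2 : (2 : ℕ∞ω) ≤ ∞ := WithTop.coe_le_coe.mpr le_top
  exact LorentzianMetric.causalFuture_subset_of_localTrichotomy hn2 𝒟.isCausallyWellBehaved
    𝒟.eq_of_mem_causalFuture_range_embed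
    (fun u ↦ 𝒟.toDataEmbedding.exists_nhds_subset_trichotomy_range u)

/-- **A future timelike complete Cauchy development contains the causal future of the data of any
Cauchy development of the same data it maps into**: `J⁺(ι₂ X) ⊆ ψ(M₁)` — the theorem
`CauchyDevelopment.causalFuture_range_embed_subset` with its acausality hypothesis discharged by
`eq_of_mem_causalFuture_range_embed`. [cite: ONeillSemiRiemannian1983, Ch. 14, Lemma 14.42 (p. 425)] -/
theorem causalFuture_range_embed_subset' {𝒟₁ 𝒟₂ : CauchyDevelopment D}
    {ψ : 𝒟₁.carrier → 𝒟₂.carrier}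
    (hψ : 𝒟₁.metric.IsIsometricImmersion 𝒟₂.metric.toPseudoRiemannianMetric ψ)
    (hτ : 𝒟₁.timeOrientation.PreservesTimeOrientation ψ 𝒟₂.timeOrientation)
    (hι : ψ ∘ 𝒟₁.embed = 𝒟₂.embed)
    (hc : ∀ [𝒟₁.metric.toPseudoRiemannianMetric.HasLeviCivita],
      ∀ (y : 𝒟₁.carrier) (w : TangentSpace (𝓡 (n + 1)) y), 𝒟₁.metric.IsTimelike w →
        𝒟₁.timeOrientation.IsFutureDirected w → w ∈ expDomain 𝒟₁.metric.leviCivita y) :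
    𝒟₂.metric.causalFuture 𝒟₂.timeOrientation (range 𝒟₂.embed) ⊆ range ψ :=
  causalFuture_range_embed_subset hψ hτ hι hc 𝒟₂.eq_of_mem_causalFuture_range_embed

/-- **From `EmbedsInto`, no acausality hypothesis**: if `𝒟₁ ↪ 𝒟₂` and `𝒟₁` is future timelike
complete (its `exp` defined on the future timecone), the unique embedding covers `J⁺(ι₂ X)`.
[cite: ONeillSemiRiemannian1983, Ch. 14, Lemma 14.42 (p. 425)] -/
theorem EmbedsInto.exists_causalFuture_range_embed_subset' {𝒟₁ 𝒟₂ : CauchyDevelopment D}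
    (h : 𝒟₁.EmbedsInto 𝒟₂)
    (hc : ∀ [𝒟₁.metric.toPseudoRiemannianMetric.HasLeviCivita],
      ∀ (y : 𝒟₁.carrier) (w : TangentSpace (𝓡 (n + 1)) y), 𝒟₁.metric.IsTimelike w →
        𝒟₁.timeOrientation.IsFutureDirected w → w ∈ expDomain 𝒟₁.metric.leviCivita y) :
    ∃ ψ : 𝒟₁.carrier → 𝒟₂.carrier,
      𝒟₁.metric.IsIsometricImmersion 𝒟₂.metric.toPseudoRiemannianMetric ψ ∧
        𝒟₁.timeOrientation.PreservesTimeOrientation ψ 𝒟₂.timeOrientation ∧ ψ ∘ 𝒟₁.embed = 𝒟₂.embed ∧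
          𝒟₂.metric.causalFuture 𝒟₂.timeOrientation (range 𝒟₂.embed) ⊆ range ψ :=
  h.exists_causalFuture_range_embed_subset hc 𝒟₂.eq_of_mem_causalFuture_range_embed

end CauchyDevelopment

end Literature.Geometry.Lorentzian

end
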